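import Summits.HodgeConjecture.CorCM.MumfordTateRankOfCMProducts
import Literature.AlgebraicGeometry.Motives.HodgeTensorFactsHolds
import Literature.AlgebraicGeometry.HodgeTheory.ComplexConjugationHolds
import Literature.AlgebraicGeometry.HodgeTheory.HodgeFiltrationModelsReductionProofs
import HarnessLib

/-!
# Mumford–Tate ranks of products of CM abelian varieties — every standing hypothesis discharged

The statements of `CorCM/MumfordTateRankOfCMProducts` and `Motives/MumfordTateRankOfCMFamilyUpperBound`
about CM abelian varieties `A_i` realising `(K_i; Φ_i)` carry, like their one-field predecessors, three
hypotheses that ARE tree theorems: the tensor-filtration class `HodgeTensorFacts` (the tree's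
`Motives.hodgeTensorFacts_holds`, Deligne Hodge II 1.1–1.2), the real model of `H^*(X(ℂ); ℂ)`
(`exists_isReal_hodgeModel`, `HodgeTheory.exists_isReal_hodgeModel_holds`) and the independence of the Hodge
pieces from the model (`hodgePQ_independent_of_hodgeModel`, `HodgeTheory.hodgePQ_independent_of_hodgeModel_holds`).
This file feeds those theorems in, so that the results read with the CM data `hA` as their ONLY input:

* `mtRank_pi_bettiHodge_eq_cmFamilyRank_holds` — **`dim MT(⊕_i H¹(A_i)) = cmFamilyRank Φ`** (Deligne 1982
  Ex. 3.7 (c) for the CM algebra `∏_i K_i`; Gordon 9.1 "`rank(K,S) := dim MT(A)`" for `A = ∏_i A_i`);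
* `isNondegenerateFamily_iff_mtRank_pi_bettiHodge_eq_holds` — Gordon 7.5 (1) ⟺ (3): the family is stably
  nondegenerate iff `dim MT(⊕_i H¹(A_i)) = Σ_i dim A_i + 1`;
* `mtRank_pi_bettiHodge_add_card_le_holds` / `…_add_card_eq_holds` — `rank Hg(∏_i A_i) ≤ Σ_i rank Hg(A_i)`,
  with equality for slotwise independent Galois actions (Gordon §3 Theorem, Imai / Murty);
* `mtRank_pi_bettiHodge_eq_card_add_one_of_finrank_eq_two_holds` — pairwise non-isogenous CM elliptic curves:
  `dim MT(⊕_i H¹(E_i)) = |I| + 1` (Moonen–Zarhin Cor. (3.9));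
* `hodgeConjectureFor_prod_of_mtRank_pi_bettiHodge_eq_holds` — Hazama–Murty on `MT`: if
  `dim MT(⊕_i H¹(A_i)) = Σ_i dim A_i + 1` then the Hodge conjecture holds for every product `∏_i A_i^{k_i}`.

Everything is a theorem (no definition, no named fact; net debt `0`).  Count-neutral; cell `pub-hodgecm2`
(COR-CM), lane MT-FAMILY, seat `pub-hodgecm2-b27` (gen 26).

## References

* [Gordon1999HodgeAVSurvey] B. B. Gordon, *A survey of the Hodge conjecture for abelian varieties* (1999), §3,
  7.5–7.7, 9.1.
* [Deligne1982HodgeCycles] P. Deligne, *Hodge cycles on abelian varieties*, LNM 900 (1982), I Ex. 3.7 (c).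
* [MoonenZarhin1999] B. Moonen, Yu. Zarhin, Math. Ann. 315 (1999), Cor. (3.9).
-/

noncomputable section

open scoped TensorProduct Classical
open CategoryTheory CategoryTheory.Limits NumberField Module

namespace Summit.HodgeConjecture.CorCM

open Literature.NumberTheory.ComplexMultiplication
open Literature.AlgebraicGeometry.Motives
open Literature.AlgebraicGeometry.Motives.HodgeStructure
open Literature.AlgebraicGeometry.HodgeTheory
open Literature.AlgebraicGeometry.ComplexMultiplication (IsCMTypeRealisation)
open Literature.AlgebraicGeometry.Pohlmann1968

variable {I : Type} [Fintype I] [DecidableEq I] {K : I → Type} [∀ i, Field (K i)]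
  [∀ i, NumberField (K i)] {Φ : ∀ i, CMType (K i)}
  {A : I → AbelianVariety ℂ} {ι : ∀ i, 𝓞 (K i) →+* End (A i)}
  {θ : ∀ i, K i →+* Module.End ℂ (complexBetti (A i).X 1)}

/-- **`dim MT(⊕_i H¹(A_i)) = cmFamilyRank Φ` for CM abelian varieties `A_i` realising `(K_i; Φ_i)`, with every
standing hypothesis discharged** (`hodgeTensorFacts_holds`, `exists_isReal_hodgeModel_holds`,
`hodgePQ_independent_of_hodgeModel_holds` fed into `mtRank_pi_bettiHodge_eq_cmFamilyRank`): Gordon 9.1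
"`rank(K,S) := dim MT(A)`" for the product `A = ∏_i A_i`, as a theorem with the CM data as its only input.
[cite: Gordon1999HodgeAVSurvey, 9.1] [cite: Deligne1982HodgeCycles, I Example 3.7 (c)] -/
theorem mtRank_pi_bettiHodge_eq_cmFamilyRank_holds (hA : ∀ i, IsCMTypeRealisation (Φ i) (A i) (ι i) (θ i)) :
    haveI := hodgeTensorFacts_holds.{0, 0}
    haveI : ∀ i, Module.Finite ℚ (bettiCohomology (A i).X 1) := fun i => BettiUniverse.finite (hA i).1 1
    (HodgeStructure.pi fun i => BettiUniverse.hodge exists_isReal_hodgeModel_holds (hA i).1 1).mtRank =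
      CMAlgebra.cmFamilyRank Φ := by
  haveI := hodgeTensorFacts_holds.{0, 0}
  exact mtRank_pi_bettiHodge_eq_cmFamilyRank hA exists_isReal_hodgeModel_holds
    hodgePQ_independent_of_hodgeModel_holds

/-- **Gordon 7.5 (1) ⟺ (3), discharged form**: the family `(Φ_i)` is nondegenerate (no product `∏_i A_i^{k_i}`
carries an exceptional Hodge class) iff `dim MT(⊕_i H¹(A_i)) = Σ_i dim A_i + 1`. [cite: Gordon1999HodgeAVSurvey, 7.5] -/
theorem isNondegenerateFamily_iff_mtRank_pi_bettiHodge_eq_holds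
    (hA : ∀ i, IsCMTypeRealisation (Φ i) (A i) (ι i) (θ i)) :
    haveI := hodgeTensorFacts_holds.{0, 0}
    haveI : ∀ i, Module.Finite ℚ (bettiCohomology (A i).X 1) := fun i => BettiUniverse.finite (hA i).1 1
    CMAlgebra.IsNondegenerateFamily Φ ↔
      (HodgeStructure.pi fun i => BettiUniverse.hodge exists_isReal_hodgeModel_holds (hA i).1 1).mtRank =
        (∑ i, finrank ℚ (K i)) / 2 + 1 := by
  haveI := hodgeTensorFacts_holds.{0, 0}
  exact isNondegenerateFamily_iff_mtRank_pi_bettiHodge_eq hA exists_isReal_hodgeModel_holds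
    hodgePQ_independent_of_hodgeModel_holds

/-- **`rank Hg(∏_i A_i) ≤ Σ_i rank Hg(A_i)`, discharged form**: `dim MT(⊕_i H¹(A_i)) + |I| ≤ Σ_i dim MT(H¹(A_i)) + 1`.
[cite: Gordon1999HodgeAVSurvey, §3 Theorem (proof) and 7.7] -/
theorem mtRank_pi_bettiHodge_add_card_le_holds [Nonempty I] [∀ i, IsCMField (K i)]
    (hA : ∀ i, IsCMTypeRealisation (Φ i) (A i) (ι i) (θ i)) :
    haveI := hodgeTensorFacts_holds.{0, 0}
    haveI : ∀ i, Module.Finite ℚ (bettiCohomology (A i).X 1) := fun i => BettiUniverse.finite (hA i).1 1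
    (HodgeStructure.pi fun i => BettiUniverse.hodge exists_isReal_hodgeModel_holds (hA i).1 1).mtRank +
        Fintype.card I ≤
      (∑ i, (BettiUniverse.hodge exists_isReal_hodgeModel_holds (hA i).1 1).mtRank) + 1 := by
  haveI := hodgeTensorFacts_holds.{0, 0}
  exact mtRank_pi_bettiHodge_add_card_le hA exists_isReal_hodgeModel_holds hodgePQ_independent_of_hodgeModel_holds

/-- **Gordon §3 Theorem (Imai, Murty) for arbitrary CM factors with slotwise independent Galois actions,
discharged form**: `dim MT(⊕_i H¹(A_i)) + |I| = Σ_i dim MT(H¹(A_i)) + 1`, i.e. `rank Hg(∏_i A_i) = Σ_i rank Hg(A_i)`.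
[cite: Gordon1999HodgeAVSurvey, §3 Theorem (1)] -/
theorem mtRank_pi_bettiHodge_add_card_eq_holds [Nonempty I] [∀ i, IsCMField (K i)]
    (hind : SlotwiseIndependent (ℂ ≃+* ℂ) fun i => K i →+* ℂ)
    (hA : ∀ i, IsCMTypeRealisation (Φ i) (A i) (ι i) (θ i)) :
    haveI := hodgeTensorFacts_holds.{0, 0}
    haveI : ∀ i, Module.Finite ℚ (bettiCohomology (A i).X 1) := fun i => BettiUniverse.finite (hA i).1 1
    (HodgeStructure.pi fun i => BettiUniverse.hodge exists_isReal_hodgeModel_holds (hA i).1 1).mtRank +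
        Fintype.card I =
      (∑ i, (BettiUniverse.hodge exists_isReal_hodgeModel_holds (hA i).1 1).mtRank) + 1 := by
  haveI := hodgeTensorFacts_holds.{0, 0}
  exact mtRank_pi_bettiHodge_add_card_eq hind hA exists_isReal_hodgeModel_holds
    hodgePQ_independent_of_hodgeModel_holds

/-- **Moonen–Zarhin Cor. (3.9) on the Mumford–Tate group, discharged form**: for a separating family of CM types of
imaginary quadratic fields (pairwise non-isogenous CM elliptic curves `E_i`), `dim MT(⊕_i H¹(E_i)) = |I| + 1`.
[cite: MoonenZarhin1999, Cor. (3.9)] -/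
theorem mtRank_pi_bettiHodge_eq_card_add_one_of_finrank_eq_two_holds [Nonempty I] [∀ i, IsCMField (K i)]
    (hK : ∀ i, finrank ℚ (K i) = 2)
    (hsep : CMAlgebra.IsSeparatingFamily Φ) (hA : ∀ i, IsCMTypeRealisation (Φ i) (A i) (ι i) (θ i)) :
    haveI := hodgeTensorFacts_holds.{0, 0}
    haveI : ∀ i, Module.Finite ℚ (bettiCohomology (A i).X 1) := fun i => BettiUniverse.finite (hA i).1 1
    (HodgeStructure.pi fun i => BettiUniverse.hodge exists_isReal_hodgeModel_holds (hA i).1 1).mtRank =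
      Fintype.card I + 1 := by
  haveI := hodgeTensorFacts_holds.{0, 0}
  exact mtRank_pi_bettiHodge_eq_card_add_one_of_finrank_eq_two hK hsep hA exists_isReal_hodgeModel_holds
    hodgePQ_independent_of_hodgeModel_holds

/-- **Hazama–Murty on the Mumford–Tate group, discharged form**: if `dim MT(⊕_i H¹(A_i)) = Σ_i dim A_i + 1` then the
Hodge conjecture holds for every product `⨁_{j<N} A_{π j}` of the CM abelian varieties `A_i` realising `(K_i; Φ_i)`.
[cite: Gordon1999HodgeAVSurvey, Thm 6.4 and 7.5] -/
theorem hodgeConjectureFor_prod_of_mtRank_pi_bettiHodge_eq_holds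
    [Nonempty I] [∀ i, IsCMField (K i)] (hA : ∀ i, IsCMTypeRealisation (Φ i) (A i) (ι i) (θ i))
    (h : haveI := hodgeTensorFacts_holds.{0, 0}
      haveI : ∀ i, Module.Finite ℚ (bettiCohomology (A i).X 1) := fun i => BettiUniverse.finite (hA i).1 1
      (HodgeStructure.pi fun i => BettiUniverse.hodge exists_isReal_hodgeModel_holds (hA i).1 1).mtRank =
        (∑ i, finrank ℚ (K i)) / 2 + 1)
    {N : ℕ} (π : Fin N → I) :
    HodgeConjectureFor (⨁ fun j : Fin N => A (π j)).dim (⨁ fun j : Fin N => A (π j)).X := by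
  haveI := hodgeTensorFacts_holds.{0, 0}
  exact hodgeConjectureFor_prod_of_mtRank_pi_bettiHodge_eq hA exists_isReal_hodgeModel_holds
    hodgePQ_independent_of_hodgeModel_holds h π

end Summit.HodgeConjecture.CorCM

end
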